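import Literature.NumberTheory.Automorphic.RankinSelbergEisensteinWeight
import Literature.NumberTheory.Automorphic.RankinSelbergThetaBound
import Literature.NumberTheory.Automorphic.JacquetShalikaSchurSelfSumOfTorusFiniteness
import Literature.NumberTheory.Automorphic.StandardTestFunSchwartzBruhat
import Literature.NumberTheory.Automorphic.PairLFunctionBaseChangeProofs
import HarnessLib

/-!
# Finiteness of the unfolded Rankin–Selberg integral, and Jacquet–Shalika's Theorem (5.3) for pairs

Topic `NumberTheory/Automorphic`; namespace `Literature.NumberTheory.Automorphic`. The keystone of the
real-point Rankin–Selberg method on `GL_n` in the tree (Jacquet–Shalika, *On Euler products and the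
classification of automorphic representations I*, Amer. J. Math. **103** (1981), §4 and Thm. (5.3);
Cogdell (2004), §2.3): the hypothesis `hfin` of
`JacquetShalika1981_schurSelfSum_prod_bounded_of_rankinSelbergTorusIntegral_ne_top`
(`JacquetShalikaSchurSelfSumOfTorusFiniteness`) — finiteness of
`Ψ(σ) = rankinSelbergTorusIntegral νA νK W_φ (Φ_∞ ⊗ 𝟙_{𝒪̂ⁿ}) σ` for the Whittaker coefficient of every
smoothed `L²` cusp form and every `σ > 1` — is proved, for Haar measures and the archimedean test function
`Φ_∞(z) = e^{-‖z‖}` (`jsArchTestFun`, positive, continuous, decaying to every order), by the chain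

  `C · Ψ(σ) = I^{(0)} ≤ I^{(n-1)} = ∫ ‖φ‖² w β_{P_n(K)} = ∫ ‖φ‖² E_w β_{GL_n(K)} ≤ ∫_{A_G 𝔖} ‖φ‖² E_w ≤ (Σ_j ε_j) ν(shell₀) < ∞`

(`RankinSelbergTowerComparison`, `WhittakerTowerChain`, `RankinSelbergEisensteinWeight`,
`SiegelShellDomination` with reduction theory `reductionTheory_gl_holds`, `RankinSelbergThetaBound` with the
rapid decay `isRapidlyDecreasingGL_smoothedForm_inv`, and `measure_mul_siegelSet_lt_top`). Consequently the
named facts are theorems: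

* `rankinSelbergTorusIntegral_whittakerCoeff_ne_top` — **`hfin`**;
* `JacquetShalika1981_schurSelfSum_prod_bounded_holds` — Jacquet–Shalika's (5.3.3)–(5.3.4) off large
  finite sets (`JacquetShalikaSchurSelfSum`), in every rank;
* `JacquetShalika1981_multipliable_partialPairL_holds` — **Theorem (5.3) for pairs**: the partial
  Rankin–Selberg Euler product `∏_{v ∉ S} det(1 - q_v^{-s} A_v ⊗ A'_v)⁻¹` of two cuspidal representations is
  multipliable for `re s > 1` (`PairLFunctionBaseChange`;
  `JacquetShalika1981_multipliable_partialPairL_of_schurSelfSum_prod_bounded`).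

## References

* H. Jacquet, J. A. Shalika, *On Euler products and the classification of automorphic representations
  I*, Amer. J. Math. 103 (1981), 499–558: §4; Lemma (5.2), Thm. (5.3), (5.3.3)–(5.3.5), pp. 554–557
  [JacquetShalikaAJM1981].
* J. W. Cogdell, *Analytic theory of L-functions for GL_n*, in *An Introduction to the Langlands Program*
  (2004), §2.3, Thm. 2.2 [CogdellAnalyticTheory2004].
-/

noncomputable section

open MeasureTheory Measure NumberField NumberField.mixedEmbedding IsDedekindDomain Matrix Set Filter Topology Module
open scoped MatrixGroups ENNReal NNReal Pointwise Classical
open Literature.NumberTheory.GaloisRepresentations (ideleGroup)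

namespace Literature.NumberTheory.Automorphic

/-! ### The archimedean test function `e^{-‖z‖}` -/

section TestFun

variable (n : ℕ) (K : Type) [Field K] [NumberField K]

/-- **The archimedean test function `Φ_∞(z) = e^{-‖z‖}`** on `K_∞ⁿ`, the norm being read in the mixed
space `(ℝ^{r₁} × ℂ^{r₂})ⁿ` (as in `vecInfinitePart`): positive, continuous and decaying faster than any
power. (The printed choice is a Gaussian; any such function serves.) [folklore] -/
def jsArchTestFun (z : Fin n → InfiniteAdeleRing K) : ℝ :=
  Real.exp (-‖fun i => InfiniteAdeleRing.ringEquiv_mixedSpace K (z i)‖)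

/-- `Φ_∞ > 0`. [folklore] -/
theorem jsArchTestFun_pos (z : Fin n → InfiniteAdeleRing K) : 0 < jsArchTestFun n K z := Real.exp_pos _

/-- `Φ_∞` is continuous. [folklore] -/
theorem continuous_jsArchTestFun : Continuous (jsArchTestFun n K) :=
  Real.continuous_exp.comp (continuous_neg.comp (continuous_norm.comp
    (continuous_pi fun i => (continuous_ringEquiv_mixedSpace K).comp (continuous_apply i))))

/-- `e^{-t} ≤ e · k! · (1 + t)^{-k}` for `t ≥ 0` (`(1+t)^k / k! ≤ e^{1+t}`). [folklore] -/
theorem exp_neg_le_mul_one_add_rpow_neg (k : ℕ) {t : ℝ} (ht : 0 ≤ t) :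
    Real.exp (-t) ≤ Real.exp 1 * k.factorial * (1 + t) ^ (-(k : ℝ)) := by
  have h1 : 0 < 1 + t := by linarith
  have h := Real.pow_div_factorial_le_exp (1 + t) h1.le k
  rw [div_le_iff₀ (Nat.cast_pos.2 (Nat.factorial_pos k)), Real.exp_add] at h
  rw [Real.rpow_neg h1.le, Real.rpow_natCast, Real.exp_neg]
  rw [le_mul_inv_iff₀ (pow_pos h1 k), inv_mul_le_iff₀ (Real.exp_pos t)]
  nlinarith [Real.exp_pos t, Real.exp_pos 1, h]

/-- The standard test function `Φ = Φ_∞ ⊗ 𝟙_{𝒪̂ⁿ}` is non-negative. [folklore] -/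
theorem standardTestFun_jsArchTestFun_nonneg (y : Fin n → AdeleRing (𝓞 K) K) :
    0 ≤ standardTestFun n K (jsArchTestFun n K) y :=
  standardTestFun_nonneg (fun z => (jsArchTestFun_pos n K z).le) y

/-- **Archimedean decay of `Φ` to every order.** [folklore] -/
theorem standardTestFun_jsArchTestFun_decay (k : ℕ) :
    ∃ M : ℝ, 0 ≤ M ∧ ∀ x : Fin n → AdeleRing (𝓞 K) K,
      ‖((standardTestFun n K (jsArchTestFun n K) x : ℝ) : ℂ)‖ ≤ M * (1 + ‖vecInfinitePart K n x‖) ^ (-(k : ℝ)) := by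
  refine ⟨Real.exp 1 * k.factorial, by positivity, fun x => ?_⟩
  rw [Complex.norm_real, Real.norm_of_nonneg (standardTestFun_jsArchTestFun_nonneg n K x)]
  unfold standardTestFun
  split_ifs
  · exact exp_neg_le_mul_one_add_rpow_neg k (norm_nonneg _)
  · positivity

/-- **`Φ` vanishes unless the finite part is integral** (`𝒪̂ⁿ` is compact). [folklore] -/
theorem standardTestFun_jsArchTestFun_finiteSupport :
    ∃ Cf : Set (Fin n → FiniteAdeleRing (𝓞 K) K), IsCompact Cf ∧ ∀ x : Fin n → AdeleRing (𝓞 K) K,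
      vecFinitePart K n x ∉ Cf → ((standardTestFun n K (jsArchTestFun n K) x : ℝ) : ℂ) = 0 := by
  refine ⟨{z | ∀ (i : Fin n) (w : HeightOneSpectrum (𝓞 K)), z i w ∈ w.adicCompletionIntegers K},
    isCompact_integralFiniteAdeleVec n K, fun x hx => ?_⟩
  unfold standardTestFun
  rw [if_neg (show ¬ (∀ (i : Fin n) (w : HeightOneSpectrum (𝓞 K)), (x i).2 w ∈ w.adicCompletionIntegers K) from hx),
    Complex.ofReal_zero]

/-- **`Φ` is continuous** (`𝒪̂ⁿ` is clopen, `Φ_∞` is continuous). [folklore] -/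
theorem continuous_standardTestFun_jsArchTestFun : Continuous (standardTestFun n K (jsArchTestFun n K)) := by
  have hU : IsClopen {y : Fin n → AdeleRing (𝓞 K) K | ∀ (i : Fin n) (w : HeightOneSpectrum (𝓞 K)),
      (y i).2 w ∈ w.adicCompletionIntegers K} :=
    (isClopen_integralFiniteAdeleVec n K).preimage (continuous_pi fun i => continuous_snd.comp (continuous_apply i))
  have hf : Continuous fun y : Fin n → AdeleRing (𝓞 K) K => jsArchTestFun n K fun i => (y i).1 :=
    (continuous_jsArchTestFun n K).comp (continuous_pi fun i => continuous_fst.comp (continuous_apply i))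
  have heq : standardTestFun n K (jsArchTestFun n K) =
      {y : Fin n → AdeleRing (𝓞 K) K | ∀ (i : Fin n) (w : HeightOneSpectrum (𝓞 K)),
        (y i).2 w ∈ w.adicCompletionIntegers K}.indicator fun y => jsArchTestFun n K fun i => (y i).1 := by
    funext y
    unfold standardTestFun
    classical
    rw [Set.indicator_apply]
    rfl
  rw [heq]
  exact hU.continuous_indicator hf

end TestFun

/-! ### The top of the Whittaker tower is finite -/

section Finiteness

variable {n : ℕ} {K : Type} [Field K] [NumberField K]
  {μ : Measure (AdelicGroupData.gl n K).automorphicQuotient}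
  [(AdelicGroupData.gl n K).IsAutomorphicMeasure μ]

-- Borel structures as in `JacquetShalikaSchurSelfSumOfTorusFiniteness`.
attribute [local instance] adelicBorel borelSpace_adelic locallyCompactSpace_adelic
  secondCountableTopology_gl_adelic glAdeleBorel borelSpace_glAdele

/-- `invQuot (S_η f)` is invariant under the centre `A_G` (`A_G ≤ A_G GL_n(K)`, `invQuot_mul_left`).
[folklore] -/
theorem invQuot_scalarExp_mul (F : (AdelicGroupData.gl n K).automorphicQuotient → ℂ) (τ : ℝ)
    (g : GL (Fin n) (AdeleRing (𝓞 K) K)) :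
    invQuot (AdelicGroupData.gl n K) F (scalarExp n K τ * g) = invQuot (AdelicGroupData.gl n K) F g :=
  invQuot_mul_left _ F (Subgroup.mem_sup_left ⟨expUnitNNReal τ, rfl⟩) g

/-- `invQuot F` is left `GL_n(K)`-invariant, in the `map`-spelling of the Whittaker tower. [folklore] -/
theorem invQuot_map_mul (F : (AdelicGroupData.gl n K).automorphicQuotient → ℂ) (γ₀ : GL (Fin n) K)
    (x : GL (Fin n) (AdeleRing (𝓞 K) K)) :
    invQuot (AdelicGroupData.gl n K) F (Matrix.GeneralLinearGroup.map (algebraMap K (AdeleRing (𝓞 K) K)) γ₀ * x) =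
      invQuot (AdelicGroupData.gl n K) F x :=
  isLeftInvariant_invQuot _ F _ ⟨γ₀, rfl⟩ x

/-- `g ↦ Φ(v g)` is continuous for the standard test function and every row vector `v`. [folklore] -/
theorem continuous_standardTestFun_jsArchTestFun_vecMul (v : Fin n → AdeleRing (𝓞 K) K) :
    Continuous fun g : GL (Fin n) (AdeleRing (𝓞 K) K) =>
      standardTestFun n K (jsArchTestFun n K) (v ᵥ* (g : Matrix (Fin n) (Fin n) (AdeleRing (𝓞 K) K))) :=
  (continuous_standardTestFun_jsArchTestFun n K).comp (continuous_const.matrix_vecMul Units.continuous_val)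

/-- **The top of the Whittaker tower is finite.** For `0 < n`, a test function `η`, `f ∈ L²_cusp`,
`σ > 1`, a Haar measure `ν` on `GL_n(𝔸_K)` and a measurable `P_n(K)`-covering weight `β'`,

  `∫ ‖φ‖² · rsWeight Φ σ · β' dν < ∞`,  `φ = invQuot (S_η f)`, `Φ = e^{-‖·_∞‖} ⊗ 𝟙_{𝒪̂ⁿ}`

(unfold `β'` to a `GL_n(K)`-weight, dominate by `A_G 𝔖`, sum the dyadic shells). [folklore] -/
theorem lintegral_normSq_mul_rsWeight_mul_weight_ne_top (hn : 0 < n)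
    [MeasurableSpace (ideleGroup K)] [BorelSpace (ideleGroup K)]
    {η : (AdelicGroupData.gl n K).Adelic → ℝ} (hη : IsTestFunctionGL n K η)
    {f : (AdelicGroupData.gl n K).L2 μ} (hf : f ∈ cuspidalSubspace n K μ) {σ : ℝ} (hσ : 1 < σ)
    (ν : Measure (GL (Fin n) (AdeleRing (𝓞 K) K))) [IsHaarMeasure ν]
    {β' : GL (Fin n) (AdeleRing (𝓞 K) K) → ℝ≥0∞} (hβ'm : Measurable β')
    (hβ' : ∀ x, Literature.MeasureTheory.Group.coveringSum ↥(ratPoints (tailUnipotent n K (n - 1))) β' x = 1) :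
    ∫⁻ x, ENNReal.ofReal (‖invQuot (AdelicGroupData.gl n K) (smoothedForm η f) x‖ ^ 2) *
        rsWeight n K (standardTestFun n K (jsArchTestFun n K)) σ x * β' x ∂ν ≠ ⊤ := by
  haveI : T2Space (GL (Fin n) (AdeleRing (𝓞 K) K)) := t2Space_gl n K
  haveI : T2Space (AdeleRing (𝓞 K) K) := t2Space_adeleRing K
  haveI : LocallyCompactSpace (GL (Fin n) (AdeleRing (𝓞 K) K)) :=
    AdelicGroupData.locallyCompactSpace_generalLinearGroup_adeleRing K (Fin n)
  haveI : SecondCountableTopology (GL (Fin n) (AdeleRing (𝓞 K) K)) := secondCountableTopology_generalLinearGroup_adeleRing K (Fin n)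
  set φ : GL (Fin n) (AdeleRing (𝓞 K) K) → ℂ := invQuot (AdelicGroupData.gl n K) (smoothedForm η f) with hφdef
  set Φ : (Fin n → AdeleRing (𝓞 K) K) → ℝ := standardTestFun n K (jsArchTestFun n K) with hΦdef
  have hφc : Continuous φ := continuous_invQuot_smoothedForm hη.continuous hη.hasCompactSupport f
  have hφK : ∀ (γ₀ : GL (Fin n) K) (x : GL (Fin n) (AdeleRing (𝓞 K) K)),
      φ (Matrix.GeneralLinearGroup.map (algebraMap K (AdeleRing (𝓞 K) K)) γ₀ * x) = φ x :=
    fun γ₀ x => invQuot_map_mul _ γ₀ x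
  have hφZ : ∀ (τ : ℝ) (g : GL (Fin n) (AdeleRing (𝓞 K) K)), φ (scalarExp n K τ * g) = φ g :=
    fun τ g => invQuot_scalarExp_mul _ τ g
  have hφrd : IsRapidlyDecreasingGL n K φ := isRapidlyDecreasingGL_smoothedForm_inv hη hf
  have hΦ0 : ∀ x, 0 ≤ Φ x := standardTestFun_jsArchTestFun_nonneg n K
  have hΦl : Measurable fun g : GL (Fin n) (AdeleRing (𝓞 K) K) => Φ (lastRow n K g) :=
    ((continuous_standardTestFun_jsArchTestFun n K).comp continuous_lastRow).measurable
  -- (1) unfold the `P_n(K)`-weight to a `GL_n(K)`-weight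
  obtain ⟨βG, hβGm, hβG⟩ := exists_isCoveringWeight_ratPoints (n := n) (K := K) (⊤ : Subgroup (GL (Fin n) K))
  rw [lintegral_normSq_mul_rsWeight_mul_eq hn ν hφc hφK hΦl σ hβ'm hβ' hβGm hβG]
  -- (2) dominate by `A_G 𝔖` (reduction theory)
  obtain ⟨Ω, t, ht, hΩNM, hΩc, hdec⟩ := (reductionTheory_gl_holds n K).exists_mul_eq
  have hΩB : closure Ω ⊆ (standardParabolicGL (AdeleRing (𝓞 K) K) (id : Fin n → Fin n) :
      Set (GL (Fin n) (AdeleRing (𝓞 K) K))) :=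
    (isClosed_standardParabolicGL_id.closure_subset_iff).2 (hΩNM.trans upperUnitriangular_mul_normOneDiagonal_subset)
  set S₀ : Set (GL (Fin n) (AdeleRing (𝓞 K) K)) := closure Ω * siegelCone n K t *
    (standardMaximalCompactGL n K : Set (GL (Fin n) (AdeleRing (𝓞 K) K))) with hS₀
  set F : GL (Fin n) (AdeleRing (𝓞 K) K) → ℝ≥0∞ := fun x =>
    ENNReal.ofReal (‖φ x‖ ^ 2) * eisensteinWeight n K Φ σ x with hF
  have hFm : Measurable F :=
    (ENNReal.measurable_ofReal.comp (hφc.norm.pow 2).measurable).mul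
      (measurable_eisensteinWeight (fun v => (continuous_standardTestFun_jsArchTestFun_vecMul (ratVec K v)).measurable) σ)
  have hFK : ∀ (γ₀ : GL (Fin n) K) (x : GL (Fin n) (AdeleRing (𝓞 K) K)),
      F (Matrix.GeneralLinearGroup.map (algebraMap K (AdeleRing (𝓞 K) K)) γ₀ * x) = F x := by
    intro γ₀ x
    simp only [hF, hφK, eisensteinWeight_map_mul]
  have hcover : ∀ x : GL (Fin n) (AdeleRing (𝓞 K) K), ∃ γ₀ : GL (Fin n) K,
      Matrix.GeneralLinearGroup.map (algebraMap K (AdeleRing (𝓞 K) K)) γ₀ * x ∈ Set.range (scalarExp n K) * S₀ := by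
    intro x
    obtain ⟨γ, ⟨γ₀, rfl⟩, z, ⟨r, rfl⟩, ω, hω, a, ha, k, hk, hx⟩ := hdec x
    refine ⟨γ₀⁻¹, ?_⟩
    rw [← hx, map_inv]
    have : (Matrix.GeneralLinearGroup.map (algebraMap K (AdeleRing (𝓞 K) K)) γ₀)⁻¹ *
        (Matrix.GeneralLinearGroup.map (algebraMap K (AdeleRing (𝓞 K) K)) γ₀ * posRealScalar n K r * ω * a * k) =
        posRealScalar n K r * (ω * a * k) := by group
    rw [this]
    refine Set.mul_mem_mul (by rw [range_scalarExp]; exact ⟨r, rfl⟩) ⟨_, ⟨ω, subset_closure hω, a, ha, rfl⟩, k, hk, rfl⟩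
  have hdom := lintegral_mul_weight_le_setLIntegral_of_cover ν (measurableSet_range_scalarExp_mul_siegel hΩc ht)
    hcover hFm hFK hβGm hβG
  refine ne_top_of_le_ne_top ?_ hdom
  -- (3) the dyadic shells
  obtain ⟨ε, hεsum, hε⟩ := exists_shell_bound hn hφc hφrd hφZ hΦ0 (standardTestFun_jsArchTestFun_decay n K)
    (standardTestFun_jsArchTestFun_finiteSupport n K) hσ hΩc hΩB ht
  have hQ : ∀ (j : ℤ) (τ : ℝ), τ ∈ Icc (j : ℝ) (j + 1) → ∀ s ∈ S₀, F (scalarExp n K τ * s) ≤ ε j := by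
    intro j τ hτ s hs
    refine le_trans (le_of_eq ?_) (hε j τ hτ s hs)
    simp only [hF]
    rw [hφZ, eisensteinWeight_apply]
    have hsplit : ∀ v : {v : Fin n → K // v ≠ 0},
        ENNReal.ofReal (Φ (ratVec K v.1 ᵥ* ((scalarExp n K τ * s : GL (Fin n) (AdeleRing (𝓞 K) K)) :
            Matrix (Fin n) (Fin n) (AdeleRing (𝓞 K) K))) *
          (IdeleClassGroup.ideleNorm K (Matrix.GeneralLinearGroup.det (scalarExp n K τ * s)) : ℝ) ^ σ) =
        ENNReal.ofReal (Φ (ratVec K v.1 ᵥ* ((scalarExp n K τ * s : GL (Fin n) (AdeleRing (𝓞 K) K)) :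
            Matrix (Fin n) (Fin n) (AdeleRing (𝓞 K) K)))) *
          ENNReal.ofReal ((IdeleClassGroup.ideleNorm K (Matrix.GeneralLinearGroup.det (scalarExp n K τ * s)) : ℝ) ^ σ) :=
      fun v => ENNReal.ofReal_mul (hΦ0 _)
    simp_rw [hsplit]
    rw [ENNReal.tsum_mul_right, mul_comm (∑' _, _) _]
    rfl
  have hshell := setLIntegral_center_mul_le_tsum_mul ν (fun j => measurableSet_shell_siegel hΩc ht j)
    (P := fun _ => (1 : ℝ≥0∞)) (Q := F) measurable_const (fun _ _ => rfl) hQ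
  simp only [one_mul, lintegral_one, Measure.restrict_apply_univ] at hshell
  refine ne_top_of_le_ne_top (ENNReal.mul_ne_top hεsum ?_) hshell
  -- the first shell has finite volume
  rw [shell_eq_image_mul]
  exact (measure_mul_siegelSet_lt_top ν hΩc hΩB ht (isCompact_Icc.image continuous_scalarExp)
    (by rw [← range_scalarExp]; exact Set.image_subset_range _ _)).ne

/-- **`hfin`: the unfolded Rankin–Selberg integral of the Whittaker coefficient of a smoothed `L²` cusp
form is finite for `σ > 1`** (Haar measures `νA` on `(𝔸_Kˣ)ⁿ`, `νK` on `K`, `ν₀` on `N_n(𝔸_K)`; the test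
function `e^{-‖·_∞‖} ⊗ 𝟙_{𝒪̂ⁿ}`): `C Ψ(σ) = I^{(0)} ≤ I^{(n-1)} < ∞` (`RankinSelbergTowerComparison`,
`towerIntegral_zero_le` of `WhittakerTowerChain`, `lintegral_normSq_mul_rsWeight_mul_weight_ne_top`).
[cite: JacquetShalikaAJM1981, §4; Thm. (5.3), proof] -/
theorem rankinSelbergTorusIntegral_whittakerCoeff_ne_top (hn : 0 < n)
    [MeasurableSpace (ideleGroup K)] [BorelSpace (ideleGroup K)]
    (νA : Measure (Fin n → ideleGroup K)) [IsHaarMeasure νA]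
    (νK : Measure ↥(maximalCompactAdelic n K)) [IsHaarMeasure νK]
    (ν₀ : Measure ↥(adelicUnipotent n K)) [IsHaarMeasure ν₀]
    {η : (AdelicGroupData.gl n K).Adelic → ℝ} (hη : IsTestFunctionGL n K η)
    {f : (AdelicGroupData.gl n K).L2 μ} (hf : f ∈ cuspidalSubspace n K μ) {σ : ℝ} (hσ : 1 < σ) :
    rankinSelbergTorusIntegral n K νA νK
      (whittakerCoeff ν₀ (unipotentTateDomain n K) (adeleAddChar K)
        (invQuot (AdelicGroupData.gl n K) (smoothedForm η f)))
      (standardTestFun n K (jsArchTestFun n K)) σ ≠ ⊤ := by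
  haveI : T2Space (GL (Fin n) (AdeleRing (𝓞 K) K)) := t2Space_gl n K
  haveI : LocallyCompactSpace (GL (Fin n) (AdeleRing (𝓞 K) K)) :=
    AdelicGroupData.locallyCompactSpace_generalLinearGroup_adeleRing K (Fin n)
  haveI : SecondCountableTopology (GL (Fin n) (AdeleRing (𝓞 K) K)) := secondCountableTopology_generalLinearGroup_adeleRing K (Fin n)
  set ν : Measure (GL (Fin n) (AdeleRing (𝓞 K) K)) := Measure.haar with hν
  set φ : GL (Fin n) (AdeleRing (𝓞 K) K) → ℂ := invQuot (AdelicGroupData.gl n K) (smoothedForm η f) with hφdef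
  set Φ : (Fin n → AdeleRing (𝓞 K) K) → ℝ := standardTestFun n K (jsArchTestFun n K) with hΦdef
  have hφc : Continuous φ := continuous_invQuot_smoothedForm hη.continuous hη.hasCompactSupport f
  have hφK : ∀ (γ₀ : GL (Fin n) K) (x : GL (Fin n) (AdeleRing (𝓞 K) K)),
      φ (Matrix.GeneralLinearGroup.map (algebraMap K (AdeleRing (𝓞 K) K)) γ₀ * x) = φ x :=
    fun γ₀ x => invQuot_map_mul _ γ₀ x
  have hΦ0 : ∀ x, 0 ≤ Φ x := standardTestFun_jsArchTestFun_nonneg n K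
  have hΦl : Measurable fun g : GL (Fin n) (AdeleRing (𝓞 K) K) => Φ (lastRow n K g) :=
    ((continuous_standardTestFun_jsArchTestFun n K).comp continuous_lastRow).measurable
  -- covering weights for all `Q_d(K)` and the comparison constant
  obtain ⟨β, hβ⟩ := exists_isCoveringWeight_tail (n := n) (K := K)
  obtain ⟨C, hC0, -, hcmp⟩ := lintegral_towerFun_zero_rsWeight_eq_whittakerCoeff (n := n) (K := K) hn ν νA νK ν₀
  have heq := hcmp hφc hφK hΦ0 hΦl σ (hβ 0).1 (hβ 0).2
  -- the chain `I^{(0)} ≤ I^{(n-1)}` and the finiteness of the top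
  have hw : Measurable (rsWeight n K Φ σ) := measurable_rsWeight hΦl σ
  have hchain := towerIntegral_zero_le hφc hφK hw (fun u hu x => rsWeight_unipotent_mul Φ σ hu x)
    (fun γ₀ hγ x => rsWeight_ratMirabolic_mul Φ σ hγ x) ν (fun e => (hβ e).1) (fun e => (hβ e).2)
  have htop := lintegral_normSq_mul_rsWeight_mul_weight_ne_top (μ := μ) hn hη hf hσ ν (hβ (n - 1)).1 (hβ (n - 1)).2
  have hI0 : ∫⁻ x, towerFun 0 φ (rsWeight n K Φ σ) x * β 0 x ∂ν ≠ ⊤ := ne_top_of_le_ne_top htop hchain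
  rw [heq] at hI0
  intro htop'
  rw [htop', ENNReal.mul_top hC0] at hI0
  exact hI0 rfl

end Finiteness

/-! ### Jacquet–Shalika's Theorem (5.3): the named facts -/

section NamedFacts

variable {n m : ℕ} {K : Type} [Field K] [NumberField K]
  {μ : Measure (AdelicGroupData.gl n K).automorphicQuotient}
  [(AdelicGroupData.gl n K).IsAutomorphicMeasure μ]
  {μ' : Measure (AdelicGroupData.gl m K).automorphicQuotient}
  [(AdelicGroupData.gl m K).IsAutomorphicMeasure μ']

attribute [local instance] adelicBorel borelSpace_adelic locallyCompactSpace_adelic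
  secondCountableTopology_gl_adelic glAdeleBorel borelSpace_glAdele

/-- **Jacquet–Shalika's (5.3.3)–(5.3.4) off large finite sets** — the named fact
`JacquetShalika1981_schurSelfSum_prod_bounded` (`JacquetShalikaSchurSelfSum`) is a theorem in every rank:
rank `0` by `JacquetShalika1981_schurSelfSum_prod_bounded_zero`, rank `≥ 1` by
`JacquetShalika1981_schurSelfSum_prod_bounded_of_rankinSelbergTorusIntegral_ne_top` with Haar measures, the
test function `e^{-‖·_∞‖}` and `rankinSelbergTorusIntegral_whittakerCoeff_ne_top`.
[cite: JacquetShalikaAJM1981, Thm. (5.3), proof, (5.3.3)–(5.3.4); §4; §2 Prop. (2.3)] -/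
theorem JacquetShalika1981_schurSelfSum_prod_bounded_holds :
    JacquetShalika1981_schurSelfSum_prod_bounded (n := n) (K := K) (μ := μ) := by
  rcases Nat.eq_zero_or_pos n with hn0 | hn
  · subst hn0
    exact JacquetShalika1981_schurSelfSum_prod_bounded_zero
  letI : MeasurableSpace (ideleGroup K) := borel _
  haveI : BorelSpace (ideleGroup K) := ⟨rfl⟩
  haveI := locallyCompactSpace_ideleGroup K
  haveI := secondCountableTopology_ideleGroup K
  haveI : T2Space (GL (Fin n) (AdeleRing (𝓞 K) K)) := t2Space_gl n K
  haveI : LocallyCompactSpace (GL (Fin n) (AdeleRing (𝓞 K) K)) :=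
    AdelicGroupData.locallyCompactSpace_generalLinearGroup_adeleRing K (Fin n)
  haveI : CompactSpace ↥(maximalCompactAdelic n K) :=
    isCompact_iff_compactSpace.1 (isCompact_maximalCompactAdelic n K)
  haveI : LocallyCompactSpace ↥(adelicUnipotent n K) := (isClosed_adelicUnipotent n K).locallyCompactSpace
  set νA : Measure (Fin n → ideleGroup K) := Measure.haar with hνA
  set νK : Measure ↥(maximalCompactAdelic n K) := Measure.haar with hνK
  set ν₀ : Measure ↥(adelicUnipotent n K) := Measure.haar with hν₀
  exact JacquetShalika1981_schurSelfSum_prod_bounded_of_rankinSelbergTorusIntegral_ne_top hn νA νK ν₀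
    (continuous_jsArchTestFun n K) (jsArchTestFun_pos n K)
    (fun η hη f hf σ hσ => rankinSelbergTorusIntegral_whittakerCoeff_ne_top hn νA νK ν₀ hη hf hσ)

/-- **Jacquet–Shalika's Theorem (5.3) for pairs** — the named fact
`JacquetShalika1981_multipliable_partialPairL` (`PairLFunctionBaseChange`): for unitary cuspidal `π` of
`GL_n(𝔸_K)` and `π'` of `GL_m(𝔸_K)` with Satake families `A_v`, `A'_v` off `S`, the partial Euler product
`∏_{v ∉ S} det(1 - q_v^{-s} A_v ⊗ A'_v)⁻¹` is multipliable for `re s > 1`. From the bounded torus-sum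
products for `π` and `π'` (`JacquetShalika1981_schurSelfSum_prod_bounded_holds`) by
`JacquetShalika1981_multipliable_partialPairL_of_schurSelfSum_prod_bounded` (Cauchy–Schwarz (5.3.5), the
Hermitian bound `|tr(A^k)| ≤ √(n Σ_λ |s_λ(A)|²)`, Landau). [cite: JacquetShalikaAJM1981, Thm. (5.3)] -/
theorem JacquetShalika1981_multipliable_partialPairL_holds :
    JacquetShalika1981_multipliable_partialPairL (n := n) (m := m) (K := K) (μ := μ) (μ' := μ') :=
  JacquetShalika1981_multipliable_partialPairL_of_schurSelfSum_prod_bounded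
    JacquetShalika1981_schurSelfSum_prod_bounded_holds JacquetShalika1981_schurSelfSum_prod_bounded_holds

end NamedFacts

end Literature.NumberTheory.Automorphic
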